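import Summits.PneNP.PneNP.Theses.SzkEntropy
import Summits.PneNP.PneNP.Theorems.SzkEntropyPeaWorstToAvg
import Summits.PneNP.PneNP.Theorems.PeaWorstToAvg.Negative.PeaWorstToAvgStrengthenings
import Literature.Computability.Complexity.PolynomialEntropyApproximation

/-!
# PneNP / SzkEntropy — crux `PeaWorstToAvg` (stmt-PneNP-10777), negative side: the quantifier-swapped
# crux is pure advice elimination

Route `PneNP/SzkEntropy`, crux item stmt-PneNP-10777 (`PeaWorstToAvg`, `∃D ∀A` under `PEA 3 ∉ PromiseBPP'`).
Standing-disprover content (`Cruxes/PeaWorstToAvg/Disproof.lean`, §5b), landed as negative knowledge.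

The WEAK crux swaps the quantifiers: under worst-case hardness, for EVERY randomized heuristic scheme `A`
there is SOME polynomial-time samplable on-promise ensemble on which `A` violates the `HeurBPP` bound at
some `(n, m)` (the "∀A ∃D_A" shape of Gutfreund–Shaltiel–Ta-Shma for `SAT`).  In the INTENDED uniform
model this is trivially true (a uniform scheme at fixed `(n, m)` is a `PromiseBPP'`-candidate, so it errs
on some promise instance `x`, and the point mass `δ_x` is samplable).  In the TREE's model — where a
`RandAlg` carries `O(log)` bits of advice in its coin budget, `SzkEntropyPeaWorstToAvgAdviceLeak.lean`,
`PeaWorstToAvgAdviceAsymmetry.lean` — we prove it is EQUIVALENT to a statement with no average-case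
content at all:

* `szkEntropy_peaWorstToAvg_weak_iff` — weak crux `↔ (PEA 3 ∉ PromiseBPP' → no tree scheme errs with
  probability < 1/4 on every promise instance at every (n, m ≥ 2))`, i.e. "uniform worst-case hardness ⇒
  hardness against `coinLen`-advice schemes" (advice elimination for `PEA₃`);
* `szkEntropy_peaWorstToAvg_imp_weak` — the crux implies the weak crux, hence
  `szkEntropy_peaWorstToAvg_imp_noAdviceScheme`: any proof of the typed crux proves that advice
  elimination as a by-product.

So the typed crux decomposes as (DGRV's intended uniform `∃D ∀A` statement) ⊕ (advice elimination for
`PEA₃`); a planner who wants only the former should pin `RandAlg.coinLen` to a polynomial.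

References: D. Gutfreund, R. Shaltiel, A. Ta-Shma, *If NP languages are hard on the worst-case, then it
is easy to find their hard instances*, Comput. Complexity 16 (2007) 412–441 (as reported in S. Hirahara,
FOCS 2018, p. 21); A. Bogdanov, L. Trevisan, *Average-Case Complexity* (2006), §2.3, Def. 2.12–2.13;
R. Karp, R. Lipton, Enseign. Math. 28 (1982); S. Arora, B. Barak (2009), §6.3;
Z. Dvir, D. Gutfreund, G. N. Rothblum, S. Vadhan, ICS 2011, pp. 2–3.
-/

namespace Summit.PneNP.PneNP.Theorems

open Literature.Computability.Complexity Literature.Computability.MetaComplexity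
open Summit.PneNP.PneNP.Theses.SzkEntropy
open _root_.Computability

/-- **The crux implies its quantifier-swapped (weak) form.** [BogdanovTrevisan2006, Def. 2.12–2.13] -/
theorem szkEntropy_peaWorstToAvg_imp_weak (h : PeaWorstToAvg) (hB : PEA 3 ∉ PromiseBPP')
    (A : RandAlg (List Bool × ℕ × ℕ) Bool) (hA : A.IsPolyTime schemeEnc encodeBool) :
    ∃ D : Ensemble, D.IsPolySamplable ∧
      (∀ n : ℕ, ∀ w ∈ (D n).support, w ∈ (PEA 3).yes ∨ w ∈ (PEA 3).no) ∧
      ∃ n m : ℕ, 0 < m ∧ 1 / (m : ℝ) <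
        D.prob n {x | 1 / 4 ≤ A.pr schemeEnc (x, n, m) {b | b ≠ (PEA 3).yes.boolIndicator x}} := by
  obtain ⟨D, hS, hsupp, hD⟩ := szkEntropy_peaWorstToAvg_iff.1 h hB
  refine ⟨D, hS, hsupp, ?_⟩
  by_contra hno
  push Not at hno
  exact hD ⟨A, hA, fun n m hm => hno n m hm⟩

/-- **The weak crux is EXACTLY advice elimination for `PEA₃`.**  (→) a tree scheme correct on the
promise at every `m ≥ 2` beats every on-promise ensemble (at `m = 1` the bound `≤ 1/1` is void, at
`m ≥ 2` its bad set misses the support); (←) if the scheme errs with probability `≥ 1/4` on the promise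
instance `x` at some `(n, m ≥ 2)`, the constant point mass `δ_x` (`isPolySamplable_const`) has bad-set
mass `1 > 1/m` there. [AroraBarakCC2009, §6.3; KarpLipton1982; BogdanovTrevisan2006, §2.3] -/
theorem szkEntropy_peaWorstToAvg_weak_iff :
    (PEA 3 ∉ PromiseBPP' → ∀ A : RandAlg (List Bool × ℕ × ℕ) Bool, A.IsPolyTime schemeEnc encodeBool →
      ∃ D : Ensemble, D.IsPolySamplable ∧
        (∀ n : ℕ, ∀ w ∈ (D n).support, w ∈ (PEA 3).yes ∨ w ∈ (PEA 3).no) ∧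
        ∃ n m : ℕ, 0 < m ∧ 1 / (m : ℝ) <
          D.prob n {x | 1 / 4 ≤ A.pr schemeEnc (x, n, m) {b | b ≠ (PEA 3).yes.boolIndicator x}}) ↔
    (PEA 3 ∉ PromiseBPP' → ¬ ∃ A : RandAlg (List Bool × ℕ × ℕ) Bool, A.IsPolyTime schemeEnc encodeBool ∧
      ∀ (n m : ℕ), 2 ≤ m → ∀ x : List Bool, (x ∈ (PEA 3).yes ∨ x ∈ (PEA 3).no) →
        A.pr schemeEnc (x, n, m) {b | b ≠ (PEA 3).yes.boolIndicator x} < 1 / 4) := by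
  constructor
  · rintro h hB ⟨A, hA, hcorr⟩
    obtain ⟨D, -, hsupp, n, m, hm, hlt⟩ := h hB A hA
    rcases Nat.lt_or_ge m 2 with hm2 | hm2
    · have hm1 : m = 1 := by omega
      subst hm1
      have := D.prob_le_one n
        {x | 1 / 4 ≤ A.pr schemeEnc (x, n, 1) {b | b ≠ (PEA 3).yes.boolIndicator x}}
      norm_num at hlt
      linarith
    · have hdisj : Disjoint (D n).support
          {x | 1 / 4 ≤ A.pr schemeEnc (x, n, m) {b | b ≠ (PEA 3).yes.boolIndicator x}} :=
        Set.disjoint_left.2 fun x hx hbad => absurd hbad (not_le.2 (hcorr n m hm2 x (hsupp n x hx)))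
      have h0 : D.prob n {x | 1 / 4 ≤ A.pr schemeEnc (x, n, m)
          {b | b ≠ (PEA 3).yes.boolIndicator x}} = 0 := by
        rw [Ensemble.prob, (PMF.toOuterMeasure_apply_eq_zero_iff _ _).2 hdisj, ENNReal.toReal_zero]
      rw [h0] at hlt
      have : (0 : ℝ) < 1 / (m : ℝ) := by positivity
      linarith
  · intro h hB A hA
    have hno : ¬ ∀ (n m : ℕ), 2 ≤ m → ∀ x : List Bool, (x ∈ (PEA 3).yes ∨ x ∈ (PEA 3).no) →
        A.pr schemeEnc (x, n, m) {b | b ≠ (PEA 3).yes.boolIndicator x} < 1 / 4 :=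
      fun hall => h hB ⟨A, hA, hall⟩
    push Not at hno
    obtain ⟨n, m, hm, x, hx, hbad⟩ := hno
    refine ⟨fun _ => PMF.pure x, isPolySamplable_const x, fun k w hw => ?_, n, m, by omega, ?_⟩
    · have : w = x := by simpa using hw
      rw [this]
      exact hx
    · have hmem : x ∈ {x | 1 / 4 ≤ A.pr schemeEnc (x, n, m) {b | b ≠ (PEA 3).yes.boolIndicator x}} :=
        hbad
      have h1 : Ensemble.prob (fun _ => PMF.pure x) n
          {x | 1 / 4 ≤ A.pr schemeEnc (x, n, m) {b | b ≠ (PEA 3).yes.boolIndicator x}} = 1 := by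
        rw [Ensemble.prob, PMF.toOuterMeasure_pure_apply, if_pos hmem, ENNReal.toReal_one]
      rw [h1]
      have hm' : (2 : ℝ) ≤ m := by exact_mod_cast hm
      rw [div_lt_one (by positivity)]
      linarith

/-- **Any proof of the typed crux proves advice elimination for `PEA₃`**: `PeaWorstToAvg` and
`PEA 3 ∉ PromiseBPP'` exclude every tree scheme (advice allowed) that is correct on the promise at all
`(n, m ≥ 2)`. [AroraBarakCC2009, §6.3; DvirGutfreundRothblumVadhan2010, pp. 2–3] -/
theorem szkEntropy_peaWorstToAvg_imp_noAdviceScheme (h : PeaWorstToAvg) (hB : PEA 3 ∉ PromiseBPP') :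
    ¬ ∃ A : RandAlg (List Bool × ℕ × ℕ) Bool, A.IsPolyTime schemeEnc encodeBool ∧
      ∀ (n m : ℕ), 2 ≤ m → ∀ x : List Bool, (x ∈ (PEA 3).yes ∨ x ∈ (PEA 3).no) →
        A.pr schemeEnc (x, n, m) {b | b ≠ (PEA 3).yes.boolIndicator x} < 1 / 4 :=
  szkEntropy_peaWorstToAvg_weak_iff.1 (fun hB' A hA => szkEntropy_peaWorstToAvg_imp_weak h hB' A hA) hB

end Summit.PneNP.PneNP.Theorems
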